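import Summits.ValiantsHypothesis.ValiantsHypothesis.Theorems.LangWeilTransferTameResolutionNoether

/-!
# LangWeilTransfer, support item `TameResolution` (stmt-ValiantsHypothesis-6378) — integer linear
# Noether position with the shape of the forward coordinate change

Route `LangWeilTransfer` of `ValiantsHypothesis` (conditional route; honest framing: bookkeeping,
nothing here bears on VP ≠ VNP). Same induction as `LangWeilTransferTameResolutionNoether`
(step (N) of the architecture note of val-lit-p6 g9), carrying one more invariant: the forward
change `Γ : ℤ[Y] ≃ ℤ[T][X']` sends every original variable to a polynomial of `X'`-degree `≤ 1`
(it is in fact an integer linear form; only the `X'`-degree is recorded here). This is what turns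
the graph relations `ξ_j ρ = V_j(u)` of the fibre coordinates into graph relations for the original
coordinates `y_i = Γ(X_i)(T̄, ξ)`.

* `noether_indep_case_linear`, `noether_induction_linear`, `exists_integer_noether_position_linear`.
-/

noncomputable section

open MvPolynomial

-- the summit and the problem share the name `ValiantsHypothesis` (D-0017 single-conjunct layout)
set_option linter.dupNamespace false

namespace Summit.ValiantsHypothesis.ValiantsHypothesis.Theorems.LangWeilTransfer

variable {F₀ : Type*} [Field F₀] [CharZero F₀]

/-! ### The induction -/

/-- The independent case, with the degree-`≤ 1` bookkeeping of the forward change. -/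
theorem noether_indep_case_linear {i p : ℕ} (a : Fin i → F₀) (b : Fin p → F₀) (ha : AlgebraicIndependent ℚ a)
    (hb : ∀ l, IsIntegral (Algebra.adjoin ℚ (Set.range a)) (b l)) :
    ∃ (r n : ℕ) (Γ : MvPolynomial (Fin i) ℤ ≃+* MvPolynomial (Fin n) (MvPolynomial (Fin r) ℤ)), n + r = i ∧
      (∀ i₀, (Γ (X i₀)).totalDegree ≤ 1) ∧
      AlgebraicIndependent ℚ (fun k => eval₂Hom (Int.castRingHom F₀) a (Γ.symm (C (X k)))) ∧
      (∀ j, IsIntegral (Algebra.adjoin ℚ (Set.range fun k => eval₂Hom (Int.castRingHom F₀) a (Γ.symm (C (X k)))))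
        (eval₂Hom (Int.castRingHom F₀) a (Γ.symm (X j)))) ∧
      (∀ l, IsIntegral (Algebra.adjoin ℚ (Set.range fun k => eval₂Hom (Int.castRingHom F₀) a (Γ.symm (C (X k)))))
        (b l)) := by
  refine ⟨i, 0, (isEmptyRingEquiv (MvPolynomial (Fin i) ℤ) (Fin 0)).symm, by omega, fun i₀ => by
    rw [isEmptyRingEquiv_symm_apply, totalDegree_C]; exact zero_le_one, ?_⟩
  have hT : (fun k => eval₂Hom (Int.castRingHom F₀) a
      ((isEmptyRingEquiv (MvPolynomial (Fin i) ℤ) (Fin 0)).symm.symm (C (X k)))) = a := by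
    funext k
    rw [RingEquiv.symm_symm, isEmptyRingEquiv_eq_coeff_zero, coeff_zero_C, eval₂Hom_X']
  rw [hT]
  exact ⟨ha, fun j => Fin.elim0 j, hb⟩

/-- **The induction** behind `exists_integer_noether_position_linear` (as `noether_induction`, plus the
invariant that the forward change of coordinates has `X'`-degree `≤ 1` on variables). -/
theorem noether_induction_linear (i : ℕ) : ∀ (p : ℕ) (a : Fin i → F₀) (b : Fin p → F₀),
    (∀ l, IsIntegral (Algebra.adjoin ℚ (Set.range a)) (b l)) →
    ∃ (r n : ℕ) (Γ : MvPolynomial (Fin i) ℤ ≃+* MvPolynomial (Fin n) (MvPolynomial (Fin r) ℤ)), n + r = i ∧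
      (∀ i₀, (Γ (X i₀)).totalDegree ≤ 1) ∧
      AlgebraicIndependent ℚ (fun k => eval₂Hom (Int.castRingHom F₀) a (Γ.symm (C (X k)))) ∧
      (∀ j, IsIntegral (Algebra.adjoin ℚ (Set.range fun k => eval₂Hom (Int.castRingHom F₀) a (Γ.symm (C (X k)))))
        (eval₂Hom (Int.castRingHom F₀) a (Γ.symm (X j)))) ∧
      (∀ l, IsIntegral (Algebra.adjoin ℚ (Set.range fun k => eval₂Hom (Int.castRingHom F₀) a (Γ.symm (C (X k)))))
        (b l)) := by
  induction i with
  | zero =>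
    intro p a b hb
    exact noether_indep_case_linear a b (algebraicIndependent_empty_type) hb
  | succ i ih =>
    intro p a b hb
    by_cases hind : AlgebraicIndependent ℚ a
    · exact noether_indep_case_linear a b hind hb
    -- one shear, then the induction hypothesis on the sheared tail
    obtain ⟨w, hw⟩ := exists_shear_isIntegral_nat a hind
    set a' : Fin i → F₀ := fun k => a k.succ - (w k : F₀) * a 0 with ha'
    have hrange : ∀ y ∈ Set.range a, IsIntegral (Algebra.adjoin ℚ (Set.range a')) y := by
      rintro _ ⟨j, rfl⟩
      refine Fin.cases ?_ (fun k => ?_) j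
      · exact hw
      · -- `a k.succ = a' k + w_k a 0`
        have hmem : a k.succ ∈ Algebra.adjoin ℚ (Set.range a' ∪ {a 0}) := by
          have h1 : a' k ∈ Algebra.adjoin ℚ (Set.range a' ∪ {a 0}) :=
            Algebra.subset_adjoin (Or.inl ⟨k, rfl⟩)
          have h2 : a 0 ∈ Algebra.adjoin ℚ (Set.range a' ∪ {a 0}) :=
            Algebra.subset_adjoin (Or.inr rfl)
          have : a k.succ = a' k + (w k : F₀) * a 0 := by rw [ha']; ring
          rw [this]
          exact add_mem h1 (mul_mem (natCast_mem (Algebra.adjoin ℚ (Set.range a' ∪ {a 0})) (w k)) h2)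
        have hint' : IsIntegral (Algebra.adjoin ℚ (Set.range a' ∪ {a 0})) (a k.succ) := by
          have : a k.succ = algebraMap (Algebra.adjoin ℚ (Set.range a' ∪ {a 0})) F₀ ⟨_, hmem⟩ := rfl
          rw [this]; exact isIntegral_algebraMap
        refine isIntegral_adjoin_of_tower (Set.range a') (Set.range a' ∪ {a 0}) ?_ hint'
        rintro y (⟨k', rfl⟩ | rfl)
        · have : a' k' = algebraMap (Algebra.adjoin ℚ (Set.range a')) F₀ ⟨_, Algebra.subset_adjoin ⟨k', rfl⟩⟩ := rfl
          rw [this]; exact isIntegral_algebraMap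
        · exact hw
    have hb' : ∀ l, IsIntegral (Algebra.adjoin ℚ (Set.range a')) ((Fin.cons (a 0) b : Fin (p + 1) → F₀) l) := by
      intro l
      refine Fin.cases ?_ (fun l₀ => ?_) l
      · simpa only [Fin.cons_zero] using hw
      · simp only [Fin.cons_succ]
        exact isIntegral_adjoin_of_tower _ _ hrange (hb l₀)
    obtain ⟨r, n, Γ', hnr, hlin', hTind, hξ, hbint⟩ := ih (p + 1) a' (Fin.cons (a 0) b) hb'
    -- the new coordinate system on `Fin (i+1)`
    let Λw := (Literature.RingTheory.NoetherNormalization.linearChangeEquiv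
      (fun k => ((w k : ℕ) : ℤ))).toRingEquiv
    let Φ₁ := (finSuccEquiv ℤ i).toRingEquiv
    let Φ₂ := Polynomial.mapEquiv Γ'
    let Φ₃ := (finSuccEquiv (MvPolynomial (Fin r) ℤ) n).toRingEquiv.symm
    let Γ : MvPolynomial (Fin (i + 1)) ℤ ≃+* MvPolynomial (Fin (n + 1)) (MvPolynomial (Fin r) ℤ) :=
      (Λw.trans Φ₁).trans (Φ₂.trans Φ₃)
    -- evaluation of the inverse coordinate change
    set πa : MvPolynomial (Fin (i + 1)) ℤ →+* F₀ := eval₂Hom (Int.castRingHom F₀) a with hπa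
    set πa' : MvPolynomial (Fin i) ℤ →+* F₀ := eval₂Hom (Int.castRingHom F₀) a' with hπa'
    have hH : (πa.comp (Λw.symm.toRingHom.comp (Φ₁.symm.toRingHom.comp (Polynomial.C)))) = πa' := by
      refine MvPolynomial.ringHom_ext (fun z => ?_) (fun k => ?_)
      · simp only [eq_intCast, map_intCast]
      · have h1 : Φ₁.symm (Polynomial.C (X k)) = X k.succ := by
          change (finSuccEquiv ℤ i).symm (Polynomial.C (X k)) = X k.succ
          rw [AlgEquiv.symm_apply_eq, finSuccEquiv_X_succ]
        have h2 : Λw.symm (X k.succ) = X k.succ + C (-((w k : ℕ) : ℤ)) * X 0 := by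
          change (Literature.RingTheory.NoetherNormalization.linearChangeEquiv
            (fun k => ((w k : ℕ) : ℤ))).symm (X k.succ) = _
          rw [Literature.RingTheory.NoetherNormalization.linearChangeEquiv, AlgEquiv.ofAlgHom_symm_apply,
            Literature.RingTheory.NoetherNormalization.linearChange_X_succ]
          rfl
        simp only [RingHom.comp_apply, RingEquiv.toRingHom_eq_coe, RingHom.coe_coe, h1, h2, hπa, hπa', ha',
          map_add, map_mul, eval₂Hom_X', map_neg, map_natCast]
        ring
    have hX0 : πa (Γ.symm (X 0)) = a 0 := by
      have e3 : Φ₃.symm (X 0 : MvPolynomial (Fin (n + 1)) (MvPolynomial (Fin r) ℤ)) = Polynomial.X := by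
        change finSuccEquiv (MvPolynomial (Fin r) ℤ) n (X 0) = Polynomial.X
        exact finSuccEquiv_X_zero
      have e2 : Φ₂.symm (Polynomial.X : Polynomial (MvPolynomial (Fin n) (MvPolynomial (Fin r) ℤ))) = Polynomial.X := by
        change Polynomial.map _ Polynomial.X = Polynomial.X
        exact Polynomial.map_X _
      have e1 : Φ₁.symm (Polynomial.X : Polynomial (MvPolynomial (Fin i) ℤ)) = X 0 := by
        change (finSuccEquiv ℤ i).symm Polynomial.X = X 0
        rw [AlgEquiv.symm_apply_eq, finSuccEquiv_X_zero]
      have e0 : Λw.symm (X 0 : MvPolynomial (Fin (i + 1)) ℤ) = X 0 := by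
        change (Literature.RingTheory.NoetherNormalization.linearChangeEquiv
          (fun k => ((w k : ℕ) : ℤ))).symm (X 0) = X 0
        rw [Literature.RingTheory.NoetherNormalization.linearChangeEquiv, AlgEquiv.ofAlgHom_symm_apply,
          Literature.RingTheory.NoetherNormalization.linearChange_X_zero]
      change πa (Λw.symm (Φ₁.symm (Φ₂.symm (Φ₃.symm (X 0))))) = a 0
      rw [e3, e2, e1, e0, hπa, eval₂Hom_X']
    have hXs : ∀ j, πa (Γ.symm (X j.succ)) = πa' (Γ'.symm (X j)) := by
      intro j
      have e3 : Φ₃.symm (X j.succ : MvPolynomial (Fin (n + 1)) (MvPolynomial (Fin r) ℤ)) = Polynomial.C (X j) := by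
        change finSuccEquiv (MvPolynomial (Fin r) ℤ) n (X j.succ) = Polynomial.C (X j)
        exact finSuccEquiv_X_succ
      have e2 : Φ₂.symm (Polynomial.C (X j) : Polynomial (MvPolynomial (Fin n) (MvPolynomial (Fin r) ℤ))) =
          Polynomial.C (Γ'.symm (X j)) := by
        change Polynomial.map _ (Polynomial.C (X j)) = _
        rw [Polynomial.map_C]; rfl
      change πa (Λw.symm (Φ₁.symm (Φ₂.symm (Φ₃.symm (X j.succ))))) = _
      rw [e3, e2, ← hH]
      rfl
    have hCX : ∀ k, πa (Γ.symm (C (X k))) = πa' (Γ'.symm (C (X k))) := by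
      intro k
      have e3 : Φ₃.symm (C (X k) : MvPolynomial (Fin (n + 1)) (MvPolynomial (Fin r) ℤ)) = Polynomial.C (C (X k)) := by
        change finSuccEquiv (MvPolynomial (Fin r) ℤ) n (C (X k)) = Polynomial.C (C (X k))
        simp only [finSuccEquiv_apply, eval₂Hom_C, RingHom.comp_apply]
      have e2 : Φ₂.symm (Polynomial.C (C (X k)) : Polynomial (MvPolynomial (Fin n) (MvPolynomial (Fin r) ℤ))) =
          Polynomial.C (Γ'.symm (C (X k))) := by
        change Polynomial.map _ (Polynomial.C (C (X k))) = _
        rw [Polynomial.map_C]; rfl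
      change πa (Λw.symm (Φ₁.symm (Φ₂.symm (Φ₃.symm (C (X k)))))) = _
      rw [e3, e2, ← hH]
      rfl
    -- the forward change keeps `X'`-degree `≤ 1`
    have hsymmC : ∀ g : MvPolynomial (Fin n) (MvPolynomial (Fin r) ℤ),
        (finSuccEquiv (MvPolynomial (Fin r) ℤ) n).symm (Polynomial.C g) = rename Fin.succ g := by
      intro g
      rw [AlgEquiv.symm_apply_eq]
      have : (Polynomial.C : MvPolynomial (Fin n) (MvPolynomial (Fin r) ℤ) →+* _) =
          (finSuccEquiv (MvPolynomial (Fin r) ℤ) n).toRingEquiv.toRingHom.comp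
            (rename (Fin.succ : Fin n → Fin (n + 1)) : MvPolynomial (Fin n) (MvPolynomial (Fin r) ℤ) →ₐ[_] _).toRingHom := by
        refine MvPolynomial.ringHom_ext (fun t => ?_) (fun k => ?_)
        · simp only [RingHom.comp_apply, AlgHom.toRingHom_eq_coe, RingHom.coe_coe, rename_C,
            RingEquiv.toRingHom_eq_coe, AlgEquiv.toRingEquiv_toRingHom, finSuccEquiv_apply, eval₂Hom_C]
        · simp only [RingHom.comp_apply, AlgHom.toRingHom_eq_coe, RingHom.coe_coe, rename_X,
            RingEquiv.toRingHom_eq_coe, AlgEquiv.toRingEquiv_toRingHom, finSuccEquiv_X_succ]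
      exact congrArg (fun h => h g) this
    have hlin : ∀ i₀, (Γ (X i₀)).totalDegree ≤ 1 := by
      intro i₀
      change (Φ₃ (Φ₂ (Φ₁ (Λw (X i₀))))).totalDegree ≤ 1
      refine Fin.cases ?_ (fun k => ?_) i₀
      · have e0 : Λw (X 0 : MvPolynomial (Fin (i + 1)) ℤ) = X 0 := by
          change Literature.RingTheory.NoetherNormalization.linearChangeEquiv _ (X 0) = X 0
          rw [Literature.RingTheory.NoetherNormalization.linearChangeEquiv_apply,
            Literature.RingTheory.NoetherNormalization.linearChange_X_zero]
        have e1 : Φ₁ (X 0 : MvPolynomial (Fin (i + 1)) ℤ) = Polynomial.X := by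
          change finSuccEquiv ℤ i (X 0) = Polynomial.X
          exact finSuccEquiv_X_zero
        have e2 : Φ₂ (Polynomial.X : Polynomial (MvPolynomial (Fin i) ℤ)) = Polynomial.X := by
          change Polynomial.map _ Polynomial.X = Polynomial.X
          exact Polynomial.map_X _
        have e3 : Φ₃ (Polynomial.X : Polynomial (MvPolynomial (Fin n) (MvPolynomial (Fin r) ℤ))) = X 0 := by
          change (finSuccEquiv (MvPolynomial (Fin r) ℤ) n).symm Polynomial.X = X 0
          rw [AlgEquiv.symm_apply_eq, finSuccEquiv_X_zero]
        rw [e0, e1, e2, e3, totalDegree_X]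
      · have e0 : Λw (X k.succ : MvPolynomial (Fin (i + 1)) ℤ) = X k.succ + C ((w k : ℕ) : ℤ) * X 0 := by
          change Literature.RingTheory.NoetherNormalization.linearChangeEquiv _ (X k.succ) = _
          rw [Literature.RingTheory.NoetherNormalization.linearChangeEquiv_apply,
            Literature.RingTheory.NoetherNormalization.linearChange_X_succ]
        have e1 : Φ₁ (X k.succ + C ((w k : ℕ) : ℤ) * X 0 : MvPolynomial (Fin (i + 1)) ℤ) =
            Polynomial.C (X k) + Polynomial.C (C ((w k : ℕ) : ℤ)) * Polynomial.X := by
          change finSuccEquiv ℤ i _ = _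
          rw [map_add, map_mul, finSuccEquiv_X_succ, finSuccEquiv_X_zero]
          congr 1
          simp only [finSuccEquiv_apply, eval₂Hom_C, RingHom.comp_apply]
        have e2 : Φ₂ (Polynomial.C (X k) + Polynomial.C (C ((w k : ℕ) : ℤ)) * Polynomial.X :
            Polynomial (MvPolynomial (Fin i) ℤ)) =
            Polynomial.C (Γ' (X k)) + Polynomial.C (C (C ((w k : ℕ) : ℤ))) * Polynomial.X := by
          change Polynomial.map (Γ'.toRingHom) _ = _
          rw [Polynomial.map_add, Polynomial.map_mul, Polynomial.map_C, Polynomial.map_C, Polynomial.map_X]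
          congr 2
          simp only [RingEquiv.toRingHom_eq_coe, eq_intCast, map_intCast]
        have e3 : Φ₃ (Polynomial.C (Γ' (X k)) + Polynomial.C (C (C ((w k : ℕ) : ℤ))) * Polynomial.X :
            Polynomial (MvPolynomial (Fin n) (MvPolynomial (Fin r) ℤ))) =
            rename Fin.succ (Γ' (X k)) + C (C ((w k : ℕ) : ℤ)) * X 0 := by
          change (finSuccEquiv (MvPolynomial (Fin r) ℤ) n).symm _ = _
          have hX : (finSuccEquiv (MvPolynomial (Fin r) ℤ) n).symm Polynomial.X = X 0 := by
            rw [AlgEquiv.symm_apply_eq, finSuccEquiv_X_zero]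
          rw [map_add, map_mul, hsymmC, hsymmC, rename_C, hX]
        rw [e0, e1, e2, e3]
        refine (totalDegree_add _ _).trans (max_le ?_ ?_)
        · exact (totalDegree_rename_le _ _).trans (hlin' k)
        · refine (totalDegree_mul _ _).trans ?_
          rw [totalDegree_C, zero_add]
          rw [totalDegree_X]
    refine ⟨r, n + 1, Γ, by omega, hlin, ?_⟩
    have hTeq : (fun k => πa (Γ.symm (C (X k)))) = fun k => πa' (Γ'.symm (C (X k))) := funext hCX
    rw [hTeq]
    refine ⟨hTind, fun j => ?_, fun l => ?_⟩
    · refine Fin.cases ?_ (fun j₀ => ?_) j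
      · rw [hX0]; simpa only [Fin.cons_zero] using hbint 0
      · rw [hXs]; exact hξ j₀
    · simpa only [Fin.cons_succ] using hbint l.succ

/-! ### The statement -/

/-- **Integer linear Noether position, with linear forward change.** As
`exists_integer_noether_position`, and in addition every original coordinate is carried by `Γ` to
a polynomial of `X'`-degree `≤ 1` over `ℤ[T]` (so `y_i · ρ(T̄)` is a `ℤ[T]`-combination of `ρ(T̄)`
and the numerators `V_j(T̄, u)` of the fibre coordinates — the graph relations of the ORIGINAL
coordinates needed by `eval_div_eq_zero_of_kernel`). -/
theorem exists_integer_noether_position_linear {m : ℕ} (y : Fin m → F₀) :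
    ∃ (r n : ℕ) (Γ : MvPolynomial (Fin m) ℤ ≃+* MvPolynomial (Fin n) (MvPolynomial (Fin r) ℤ)), n + r = m ∧
      (∀ i, (Γ (X i)).totalDegree ≤ 1) ∧
      AlgebraicIndependent ℚ (fun k => eval₂Hom (Int.castRingHom F₀) y (Γ.symm (C (X k)))) ∧
      ∀ j, ∃ p : Polynomial (MvPolynomial (Fin r) ℚ), p.Monic ∧
        (p.map (aeval (fun k => eval₂Hom (Int.castRingHom F₀) y (Γ.symm (C (X k)))) :
          MvPolynomial (Fin r) ℚ →ₐ[ℚ] F₀).toRingHom).eval (eval₂Hom (Int.castRingHom F₀) y (Γ.symm (X j))) = 0 := by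
  obtain ⟨r, n, Γ, hnr, hlin, hT, hξ, -⟩ := noether_induction_linear m 0 y (Fin.elim0 ·) (fun l => Fin.elim0 l)
  refine ⟨r, n, Γ, hnr, hlin, hT, fun j => ?_⟩
  set T : Fin r → F₀ := fun k => eval₂Hom (Int.castRingHom F₀) y (Γ.symm (C (X k))) with hTdef
  -- lift the monic polynomial over the subalgebra `ℚ[T̄]` to `ℚ[T]`
  set R₁ : Subalgebra ℚ F₀ := Algebra.adjoin ℚ (Set.range T) with hR₁
  obtain ⟨p, hpm, hp⟩ := hξ j
  let ρ : MvPolynomial (Fin r) ℚ →+* R₁ :=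
    ((aeval T : MvPolynomial (Fin r) ℚ →ₐ[ℚ] F₀).codRestrict R₁ fun q => by
      rw [hR₁, ← MvPolynomial.aeval_range]; exact ⟨q, rfl⟩).toRingHom
  have hρsurj : Function.Surjective ρ := by
    rintro ⟨z, hz⟩
    rw [hR₁, ← MvPolynomial.aeval_range] at hz
    obtain ⟨q, rfl⟩ := hz
    exact ⟨q, rfl⟩
  have hlift : p ∈ Polynomial.lifts ρ := by
    rw [Polynomial.lifts_iff_coeff_lifts]
    intro k; exact hρsurj _
  obtain ⟨q, hqp, -, hqm⟩ := Polynomial.lifts_and_natDegree_eq_and_monic hlift hpm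
  refine ⟨q, hqm, ?_⟩
  have hcomp : (aeval T : MvPolynomial (Fin r) ℚ →ₐ[ℚ] F₀).toRingHom = (algebraMap R₁ F₀).comp ρ := by
    ext z <;> rfl
  rw [hcomp, ← Polynomial.map_map, hqp, Polynomial.eval_map]
  exact hp

end Summit.ValiantsHypothesis.ValiantsHypothesis.Theorems.LangWeilTransfer
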